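import Summits.ValiantsHypothesis.ValiantsHypothesis.Theorems.SymPencilPerFourTwoLineFilter

/-!
# Route `SymPencil` — LEAF 5 (`stub_twoLineFilter`) of the SING-SIX classification: a
# six-dimensional subspace with two zero rows (columns) and a per-direction family of `≤ 6`
# squares is `W_col`- or `W₂`-type (transposed) (`--supports` stmt-ValiantsHypothesis-5674
# `SdcSuperquadratic`; V-side LIST of cell `(10,6,6)`; rung currency only, nothing here bears on
# `VP ≠ VNP`)

**Theorem** (`stub_twoLineFilter`, the statement of leaf 5 of
`Cruxes/SdcSuperquadratic/Lines/sing_six_classification.lean` with `TwoZeroRows`, `TwoZeroCols`,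
`PerDirSix`, `WColType`, `W2Type`, `WColTypeT`, `W2TypeT` unfolded).  Over a field of
characteristic `0`, a `6`-dimensional `W ⊆ K^{4×4}` with two identically-zero rows (resp. columns)
such that every `y ∈ W` has the `s²`-coefficient of `per_4 (u + s y)` a combination of `≤ 6`
squares of linear functionals of `u` is `rows{p,q} × (three columns)` or
`row p ⊕ (row q inside a coordinate plane)` (resp. the transposes).

Proof: rows — `SymPencilPerFourTwoLineFilter.twoRows_filter` on the two live rows
(`rows_filter`); columns — transpose (`SymPencilPerFourLowRankSeven.sqFamilySwap_map`,
`SymPencilPerFourTwoRowsRadical.eval_perPoly_transpose`) and read the criteria back.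

With `SymPencilPerFourExoticNoSixSquares` (leaf 3) and `SymPencilPerFourCrossFilter` (leaf 4) this
is the last leaf of the V-side LIST; the LIST itself follows once Theorem A
(`SymPencilSingSixClassification*`, val-idea-18) is in the tree.  Honest framing: `27 ≤ sdc(per₄)
≤ 29` unchanged, stmt-5674 open, `VP ≠ VNP` not moved, no summit statement is proved here.  No
definitions, no named facts. [folklore]
-/

noncomputable section

-- single-conjunct layout: Sub = Summit, duplicated namespace component intended
set_option linter.dupNamespace false

namespace Summit.ValiantsHypothesis.ValiantsHypothesis.Theorems.SymPencilPerFourTwoLineFilterLeaf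

open Matrix MvPolynomial Finset Module
open Literature.Computability.AlgebraicComplexity
open Summit.ValiantsHypothesis.ValiantsHypothesis.Theorems.SymPencilPerFourTwoLineFilter
open Summit.ValiantsHypothesis.ValiantsHypothesis.Theorems.SymPencilPerFourPairingDiscSixOnto
open Summit.ValiantsHypothesis.ValiantsHypothesis.Theorems.SymPencilPerFourLowRankSeven
open Summit.ValiantsHypothesis.ValiantsHypothesis.Theorems.SymPencilPerFourTwoRowsRadical

variable {K : Type*} [Field K]

/-- **Rows.**  Two identically-zero rows + `dim 6` + per-direction `≤ 6` squares ⇒ `W_col`-type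
or `W₂`-type. [folklore] -/
theorem rows_filter [CharZero K] (W : Submodule K (Fin 4 × Fin 4 → K)) (h6 : finrank K W = 6)
    (hzero : ∃ p q : Fin 4, p ≠ q ∧ ∀ x ∈ W, ∀ j : Fin 4, x (p, j) = 0 ∧ x (q, j) = 0)
    (hP : ∀ y ∈ W, ∃ (c : Fin 6 → K) (Λ : Fin 6 → ((Fin 4 × Fin 4 → K) →ₗ[K] K)),
      ∀ u : Fin 4 × Fin 4 → K, ∃ e₀ e₁ : K, ∀ s : K,
        eval (u + s • y) (perPoly (Fin 4) K) = e₀ + s * e₁ + s ^ 2 * ∑ k, c k * (Λ k u) ^ 2) :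
    (∃ p q m : Fin 4, p ≠ q ∧ ∀ x : Fin 4 × Fin 4 → K, x ∈ W ↔
        ((∀ i j : Fin 4, i ≠ p → i ≠ q → x (i, j) = 0) ∧ x (p, m) = 0 ∧ x (q, m) = 0)) ∨
    (∃ p q m m' : Fin 4, p ≠ q ∧ m ≠ m' ∧ ∀ x : Fin 4 × Fin 4 → K, x ∈ W ↔
        ((∀ i j : Fin 4, i ≠ p → i ≠ q → x (i, j) = 0) ∧ x (q, m) = 0 ∧ x (q, m') = 0)) := by
  obtain ⟨p, q, hpq, hzero⟩ := hzero
  obtain ⟨a, b, hab, hap, haq, hbp, hbq⟩ := exists_compl_pair p q hpq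
  have hrows : ∀ x ∈ W, ∀ i j : Fin 4, i ≠ a → i ≠ b → x (i, j) = 0 := by
    intro x hx i j hia hib
    rcases fin4_of_two_pairs p q a b i hpq hab hap haq hbp hbq hia hib with rfl | rfl
    · exact (hzero x hx j).1
    · exact (hzero x hx j).2
  rcases twoRows_filter W h6 a b hab hrows hP with ⟨m, hm⟩ | ⟨m, m', hmm, hm⟩ | ⟨m, m', hmm, hm⟩
  · exact Or.inl ⟨a, b, m, hab, hm⟩
  · exact Or.inr ⟨a, b, m, m', hab, hmm, hm⟩
  · exact Or.inr ⟨b, a, m, m', hab.symm, hmm, hm⟩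

/-- **LEAF 5 — TWO-LINE FILTER**, verbatim from
`Cruxes/SdcSuperquadratic/Lines/sing_six_classification.lean` with the definitions unfolded.
[folklore] -/
theorem stub_twoLineFilter [CharZero K] :
    ∀ W : Submodule K (Fin 4 × Fin 4 → K), finrank K W = 6 →
      ((∃ p q : Fin 4, p ≠ q ∧ ∀ x ∈ W, ∀ j : Fin 4, x (p, j) = 0 ∧ x (q, j) = 0) ∨
       (∃ p q : Fin 4, p ≠ q ∧ ∀ x ∈ W, ∀ i : Fin 4, x (i, p) = 0 ∧ x (i, q) = 0)) →
      (∀ y ∈ W, ∃ (c : Fin 6 → K) (Λ : Fin 6 → ((Fin 4 × Fin 4 → K) →ₗ[K] K)),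
        ∀ u : Fin 4 × Fin 4 → K, ∃ e₀ e₁ : K, ∀ s : K,
          eval (u + s • y) (perPoly (Fin 4) K) = e₀ + s * e₁ + s ^ 2 * ∑ k, c k * (Λ k u) ^ 2) →
      (∃ p q m : Fin 4, p ≠ q ∧ ∀ x : Fin 4 × Fin 4 → K, x ∈ W ↔
          ((∀ i j : Fin 4, i ≠ p → i ≠ q → x (i, j) = 0) ∧ x (p, m) = 0 ∧ x (q, m) = 0)) ∨
      (∃ p q m m' : Fin 4, p ≠ q ∧ m ≠ m' ∧ ∀ x : Fin 4 × Fin 4 → K, x ∈ W ↔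
          ((∀ i j : Fin 4, i ≠ p → i ≠ q → x (i, j) = 0) ∧ x (q, m) = 0 ∧ x (q, m') = 0)) ∨
      (∃ p q m : Fin 4, p ≠ q ∧ ∀ x : Fin 4 × Fin 4 → K, x ∈ W ↔
          ((∀ i j : Fin 4, j ≠ p → j ≠ q → x (i, j) = 0) ∧ x (m, p) = 0 ∧ x (m, q) = 0)) ∨
      (∃ p q m m' : Fin 4, p ≠ q ∧ m ≠ m' ∧ ∀ x : Fin 4 × Fin 4 → K, x ∈ W ↔
          ((∀ i j : Fin 4, j ≠ p → j ≠ q → x (i, j) = 0) ∧ x (m, q) = 0 ∧ x (m', q) = 0)) := by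
  intro W h6 hz hP
  rcases hz with hrows | hcols
  · rcases rows_filter W h6 hrows hP with h | h
    · exact Or.inl h
    · exact Or.inr (Or.inl h)
  · -- transpose
    set Φ : (Fin 4 × Fin 4 → K) ≃ₗ[K] (Fin 4 × Fin 4 → K) :=
      LinearEquiv.funCongrLeft K K (Equiv.prodComm (Fin 4) (Fin 4)) with hΦ
    have hΦa : ∀ (x : Fin 4 × Fin 4 → K) (i j : Fin 4), Φ x (i, j) = x (j, i) := fun x i j => rfl
    set W' := W.map Φ.toLinearMap with hW'def
    have hfin : finrank K W' = 6 := by rw [hW'def, LinearEquiv.finrank_map_eq, h6]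
    have hP' := sqFamilySwap_map W Φ eval_perPoly_transpose hP
    have hmemW : ∀ x : Fin 4 × Fin 4 → K, x ∈ W ↔ Φ x ∈ W' := fun x => by
      rw [hW'def, Submodule.mem_map_equiv, LinearEquiv.symm_apply_apply]
    have hmemW' : ∀ x', x' ∈ W' → ∃ x ∈ W, x' = Φ x := fun x' hx' => by
      rw [hW'def, Submodule.mem_map] at hx'
      obtain ⟨x, hx, rfl⟩ := hx'
      exact ⟨x, hx, rfl⟩
    obtain ⟨p, q, hpq, hc⟩ := hcols
    have hrows' : ∃ p q : Fin 4, p ≠ q ∧ ∀ x ∈ W', ∀ j : Fin 4, x (p, j) = 0 ∧ x (q, j) = 0 := by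
      refine ⟨p, q, hpq, fun x' hx' j => ?_⟩
      obtain ⟨x, hx, rfl⟩ := hmemW' x' hx'
      rw [hΦa, hΦa]
      exact hc x hx j
    rcases rows_filter W' hfin hrows' hP' with ⟨p', q', m, hpq', hm⟩ | ⟨p', q', m, m', hpq', hmm, hm⟩
    · right; right; left
      refine ⟨p', q', m, hpq', fun x => ?_⟩
      rw [hmemW x, hm (Φ x)]
      simp only [hΦa]
      exact ⟨fun ⟨h1, h2, h3⟩ => ⟨fun i j hj hj' => h1 j i hj hj', h2, h3⟩,
        fun ⟨h1, h2, h3⟩ => ⟨fun i j hi hi' => h1 j i hi hi', h2, h3⟩⟩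
    · right; right; right
      refine ⟨p', q', m, m', hpq', hmm, fun x => ?_⟩
      rw [hmemW x, hm (Φ x)]
      simp only [hΦa]
      exact ⟨fun ⟨h1, h2, h3⟩ => ⟨fun i j hj hj' => h1 j i hj hj', h2, h3⟩,
        fun ⟨h1, h2, h3⟩ => ⟨fun i j hi hi' => h1 j i hi hi', h2, h3⟩⟩

end Summit.ValiantsHypothesis.ValiantsHypothesis.Theorems.SymPencilPerFourTwoLineFilterLeaf

end
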